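import Literature.Barriers.QuantumAdvantage.AaronsonChenTableauStep
import Literature.Computability.QuantumComplexity.OracleWalk
import HarnessLib

/-!
# Path tableaux of Clifford+`T` circuits with annotated oracle gates: admissibility, uniqueness, and the weighted counts

Machine-independent companion of `AaronsonChenTableauStep.lean` (the one-gate check `stepChkT`
and its value, the trusting step `AcTab.trustStep`/`stepOut`, the correct guess `guessOf`) towards
the `PSPACE^{TQBF}` simulation of Aaronson–Chen 2017, Lemma 5.3 (CCC 2017, §5.3, pp. 22–23). The
`PSPACE` predicates of that simulation are signs of integer combinations
`c₁·2^{h+1}W(S₁) + c₂·2^{h+1}W(S₂)` of set weights of the replaced circuit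
(`OraclePathSums.lean`: `two_pow_mul_annWeight`, `2^h W(S) = A_S + (√2/2) B_S`); they are obtained
(a sequel) as signs of weighted witness sums (`PSpaceSignedSum.lean`) over
TABLEAUX — the guessed items (choice bit, guess bit, label, phase) of two paths, gate by gate —
that are admissible (every item is the trusting step of the previous one and every guess is the
`TQBF`-side oracle's answer). This file is the counting behind it, with no machines:

* `Item`, `decItem`/`encItem` (items of width `iw N = N + 5`: `c a label phase₃`),
  `bits3_bitsToNat`, `decLP`/`encLP` (the `N + 3`-bit code of a state, a bijection);
* `annOf B gts` — the annotated gate list of the gate data `gts` (gates with tables) relative to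
  the base oracle `B`: languages `B ⊕ ↑tbl`;
* `itemOK` (the local condition on one item: it is the trusting step `stepOut` of the current
  state with the correct guess bit `guessOf`), `tabAdm B gts s₁ s₂ Y` (**admissibility**, Boolean,
  recursive along the gates, the two walks' items interleaved), `tabFin gts s₁ s₂ Y` (the final
  states read off the tableau), `tabAdm_cons_append`/`tabFin_cons_append`, `runSt` (a run with its
  phase from a state, `runSt_cons`);
* `sum_item`/`sum_itemOK` (exactly ONE admissible item per valid choice bit, none per invalid
  one) and **`sum_tabAdm`** — the uniqueness of the admissible tableau as a counting identity:
  `Σ_{Y ∈ {0,1}^{2(N+5)|gts| + e}} [tabAdm] · G(tabFin) = 2^e · Σ_{b,b' ∈ {0,1}^{|gts|}} G(run b, run b')`;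
* `clsTerm f S` (the pair-count summand of a set `S` of labels read off two runs) and
  `annSetA_eq_sum_runSt`/`annSetB_eq_sum_runSt`, `sum_clsTerm_clsVal`
  (`Σ clsVal = dyadicGap A_S B_S k`, with `OracleWalk.lean`'s `clsVal`, `dyadicGap`);
* counting on the other witness blocks: `sum_vector_bitsToNat_lt` (coefficients),
  `sum_vector_uTest` (multiplicities `clsWt`), `clsWt_mul_clsAcc_sub`;
* the exact sign lemma **`dyadicGap_pos_iff`** (`0 < 2^{k+1}a + ⌊2^k√2⌋b ↔ 0 < 2a + √2·b` once
  `4b² < 2^k`, by the irrationality measure of `√2`, `SqrtTwoDyadic.one_div_le_abs_sqrt_two_mul_sub`).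

## References

* S. Aaronson, L. Chen, CCC 2017, §5.3 (pp. 22–23) [AaronsonChen2017].
* L. M. Adleman, J. DeMarrais, M.-D. A. Huang, SIAM J. Comput. 26 (1997), §6, Lemma 6.10 (pairs
  of paths; one local step per gate) [AdlemanDeMarraisHuang1997].
* L. Fortnow, J. Rogers, JCSS 59 (1999), Lemma 3.2 (dyadic approximation of the acceptance
  probability) [FortnowRogers1999JCSS], as `SqrtTwoDyadicThresholds.lean` / `OracleWalk.lean`.
-/

noncomputable section

namespace Literature.Barriers.QuantumAdvantage

namespace AcTab

open _root_.Computability Literature.Computability.Complexity Literature.Computability.Cryptography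
  Literature.Computability.QuantumComplexity Literature.Computability.QuantumComplexity.ADH
  Literature.Computability.QuantumComplexity.SqrtTwoDyadic

variable {N : ℕ}

/-! ### Items -/

/-- An item of a tableau: choice bit, guess bit, label, phase. [folklore] -/
structure Item (N : ℕ) where
  /-- the choice bit used to reach this item -/
  c : Bool
  /-- the guess bit used to reach this item -/
  a : Bool
  /-- the label -/
  lab : QReg N
  /-- the phase modulo `8` -/
  ph : ℕ

/-- The width of an item: `N + 5` bits. [folklore] -/
def iw (N : ℕ) : ℕ := N + 5

/-- Reading an item off `N + 5` bits `c a ℓ₀ … ℓ_{N-1} p₀ p₁ p₂` (missing bits read as `0`). [folklore] -/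
def decItem (v : List Bool) : Item N :=
  ⟨v.getD 0 false, v.getD 1 false, fun i => v.getD (2 + i) false, bitsToNat ((v.drop (N + 2)).take 3)⟩

/-- Writing an item as `N + 5` bits. [folklore] -/
def encItem (it : Item N) : List Bool := it.c :: it.a :: (List.ofFn it.lab ++ bits3 it.ph)

/-- A decoded phase is a residue modulo `8`. [folklore] -/
theorem decItem_ph_lt (v : List Bool) : (decItem (N := N) v).ph < 8 := by
  unfold decItem
  have h := bitsToNat_lt (((v.drop (N + 2)).take 3))
  have hl : ((v.drop (N + 2)).take 3).length ≤ 3 := by simp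
  exact lt_of_lt_of_le h (by simpa using Nat.pow_le_pow_right (by norm_num : 0 < 2) hl) |>.trans_le (by norm_num)

/-- `bits3` inverts `bitsToNat` on three bits. [folklore] -/
theorem bits3_bitsToNat (p : List Bool) (hp : p.length = 3) : bits3 (bitsToNat p) = p := by
  rcases p with _ | ⟨b₀, _ | ⟨b₁, _ | ⟨b₂, _ | ⟨b₃, p⟩⟩⟩⟩ <;> simp at hp
  cases b₀ <;> cases b₁ <;> cases b₂ <;> rfl

/-- The label bits of an item of width `N + 5`. [folklore] -/
theorem ofFn_decItem_lab (v : List Bool) (hv : v.length = N + 5) :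
    List.ofFn (decItem (N := N) v).lab = (v.drop 2).take N := by
  apply List.ext_getElem
  · simp [hv]
  · intro i h1 h2
    simp only [List.getElem_ofFn, decItem, List.getElem_take, List.getElem_drop]
    rw [List.getD_eq_getElem _ _ (by rw [List.length_ofFn] at h1; omega)]

/-- The phase bits of an item of width `N + 5`. [folklore] -/
theorem bits3_decItem_ph (v : List Bool) (hv : v.length = N + 5) :
    bits3 (decItem (N := N) v).ph = v.drop (N + 2) := by
  have hl : (v.drop (N + 2)).length = 3 := by rw [List.length_drop, hv]; omega
  unfold decItem
  rw [List.take_of_length_le hl.le, bits3_bitsToNat _ hl]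

/-- An item of width `N + 5` splits as `[c, a] ++ label ++ phase`. [folklore] -/
theorem item_split (v : List Bool) (hv : v.length = N + 5) :
    v = (decItem (N := N) v).c :: (decItem (N := N) v).a :: ((v.drop 2).take N ++ v.drop (N + 2)) := by
  rcases v with _ | ⟨b₀, _ | ⟨b₁, v⟩⟩
  · simp at hv
  · simp at hv
  · simp only [decItem, List.getD_cons_zero, List.getD_cons_succ, List.drop_succ_cons, List.drop_zero,
      List.cons.injEq, true_and]
    exact (List.take_append_drop N v).symm

/-! ### Annotated gate data and admissibility -/

/-- The annotated gate list of gate data (gates with finite tables) relative to the base oracle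
`B`: the `t`-th oracle gate answers `B ⊕ ↑tbl_t` — Aaronson–Chen's replacement
`TQBF ⊕ (O ∩ K_t)`. [cite: AaronsonChen2017, §5.3 (p. 22)] -/
def annOf (B : Language Bool) (gts : List (QGate cliffordT N × List (List Bool))) : List (AnnGate N) :=
  gts.map fun gt => (gt.1, oracleJoin B {p | p ∈ gt.2})

/-- `annOf` keeps the length. [folklore] -/
@[simp] theorem length_annOf (B : Language Bool) (gts : List (QGate cliffordT N × List (List Bool))) :
    (annOf B gts).length = gts.length := List.length_map _

/-- A walk state: label and phase. [folklore] -/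
abbrev PState (N : ℕ) : Type := QReg N × ℕ

/-- `stepOut` produces phases below `8`. [folklore] -/
theorem stepOut_ph_lt' {g : QGate cliffordT N} {tbl : List (List Bool)} {c a : Bool} {w : QReg N} {φ : ℕ}
    {t : PState N} (h : stepOut g tbl c a w φ = some t) : t.2 < 8 := by
  unfold stepOut at h
  obtain ⟨⟨w', ψ⟩, -, rfl⟩ := Option.map_eq_some_iff.1 h
  exact Nat.mod_lt _ (by norm_num)

/-- The local condition on one item from the state `s`: it is the trusting step with the claimed
state, and its guess bit is the correct one. [cite: AaronsonChen2017, §5.3 (pp. 22–23)] -/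
def itemOK (B : Language Bool) (g : QGate cliffordT N) (tbl : List (List Bool)) (s : PState N) (it : Item N) : Prop :=
  stepOut g tbl it.c it.a s.1 s.2 = some (it.lab, it.ph) ∧ it.a = guessOf B g s.1

/-- `itemOK` is decidable (an equation in `Option (QReg N × ℕ)` and one in `Bool`). [folklore] -/
instance itemOK.decidable (B : Language Bool) (g : QGate cliffordT N) (tbl : List (List Bool)) (s : PState N) (it : Item N) :
    Decidable (itemOK B g tbl s it) := by
  unfold itemOK; infer_instance

/-- The state claimed by an item. [folklore] -/
def Item.st (it : Item N) : PState N := (it.lab, it.ph)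

/-- **Admissibility of a tableau** `Y` from the states `s₁, s₂` of the two walks: per gate, the
two items (walk 1 then walk 2, `N + 5` bits each) are the trusting steps of the current states with
the CORRECT guess bits, and the rest of the tableau is admissible from the new states.
[cite: AaronsonChen2017, §5.3 (pp. 22–23)] -/
def tabAdm (B : Language Bool) : List (QGate cliffordT N × List (List Bool)) → PState N → PState N → List Bool → Bool
  | [], _, _, _ => true
  | (g, tbl) :: rest, s₁, s₂, Y =>
    (decide (itemOK B g tbl s₁ (decItem (N := N) (Y.take (iw N)))) &&
      decide (itemOK B g tbl s₂ (decItem (N := N) ((Y.drop (iw N)).take (iw N))))) &&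
      tabAdm B rest (decItem (N := N) (Y.take (iw N))).st (decItem (N := N) ((Y.drop (iw N)).take (iw N))).st
        (Y.drop (2 * iw N))

/-- **The final states** read off a tableau (the states of its last items; the given states on
the empty gate list). [folklore] -/
def tabFin : List (QGate cliffordT N × List (List Bool)) → PState N → PState N → List Bool → PState N × PState N
  | [], s₁, s₂, _ => (s₁, s₂)
  | _ :: rest, _, _, Y =>
    tabFin rest (decItem (N := N) (Y.take (iw N))).st (decItem (N := N) ((Y.drop (iw N)).take (iw N))).st
      (Y.drop (2 * iw N))

/-- Reading the blocks of `u ++ (v ++ Y)` (`|u| = |v| = N + 5`). [folklore] -/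
theorem blocks_append (u v Y : List Bool) (hu : u.length = iw N) (hv : v.length = iw N) :
    (u ++ (v ++ Y)).take (iw N) = u ∧ ((u ++ (v ++ Y)).drop (iw N)).take (iw N) = v ∧
      (u ++ (v ++ Y)).drop (2 * iw N) = Y := by
  refine ⟨?_, ?_, ?_⟩
  · rw [List.take_append_of_le_length hu.ge, List.take_of_length_le hu.le]
  · rw [List.drop_append_of_le_length hu.ge, List.drop_of_length_le hu.le, List.nil_append,
      List.take_append_of_le_length hv.ge, List.take_of_length_le hv.le]
  · rw [two_mul, ← List.append_assoc, List.drop_append_of_le_length (by simp [hu, hv]),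
      List.drop_of_length_le (by simp [hu, hv]), List.nil_append]

/-- `tabAdm` through one gate, on a block-aligned tableau. [folklore] -/
theorem tabAdm_cons_append (B : Language Bool) (g : QGate cliffordT N) (tbl : List (List Bool))
    (rest : List (QGate cliffordT N × List (List Bool))) (s₁ s₂ : PState N) (u v Y : List Bool)
    (hu : u.length = iw N) (hv : v.length = iw N) :
    tabAdm B ((g, tbl) :: rest) s₁ s₂ (u ++ (v ++ Y)) =
      ((decide (itemOK B g tbl s₁ (decItem (N := N) u)) && decide (itemOK B g tbl s₂ (decItem (N := N) v))) &&
        tabAdm B rest (decItem (N := N) u).st (decItem (N := N) v).st Y) := by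
  obtain ⟨h1, h2, h3⟩ := blocks_append (N := N) u v Y hu hv
  rw [tabAdm, h1, h2, h3]

/-- `tabFin` through one gate, on a block-aligned tableau. [folklore] -/
theorem tabFin_cons_append (gt : QGate cliffordT N × List (List Bool))
    (rest : List (QGate cliffordT N × List (List Bool))) (s₁ s₂ : PState N) (u v Y : List Bool)
    (hu : u.length = iw N) (hv : v.length = iw N) :
    tabFin (gt :: rest) s₁ s₂ (u ++ (v ++ Y)) = tabFin rest (decItem (N := N) u).st (decItem (N := N) v).st Y := by
  obtain ⟨h1, h2, h3⟩ := blocks_append (N := N) u v Y hu hv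
  rw [tabFin, h1, h2, h3]

/-- The run of a choice vector from a state: endpoint and phase, or `none`. [folklore] -/
def runSt (gas : List (AnnGate N)) (s : PState N) (b : List Bool) : Option (PState N) :=
  (annPathRun gas s.1 b).map fun r => (r.1, (s.2 + r.2) % 8)

/-- `runSt` on the empty gate list (phases below `8`). [folklore] -/
theorem runSt_nil {s : PState N} (hs : s.2 < 8) : runSt [] s [] = some s := by
  rcases s with ⟨w, φ⟩
  simp only [runSt, annPathRun, Option.map_some, Nat.add_zero, Nat.mod_eq_of_lt (show φ < 8 from hs)]

/-- `runSt` through one gate: step, then run from the new state (phases added modulo `8`). [folklore] -/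
theorem runSt_cons (ga : AnnGate N) (gas : List (AnnGate N)) (s : PState N) (c : Bool) (cs : List Bool) :
    runSt (ga :: gas) s (c :: cs) =
      match annPathStep ga c s.1 with
      | none => none
      | some (w', ψ) => runSt gas (w', (s.2 + ψ) % 8) cs := by
  rcases s with ⟨w, φ⟩
  simp only [runSt, annPathRun]
  rcases annPathStep ga c w with _ | ⟨w', ψ⟩
  · rfl
  · simp only
    rcases annPathRun gas w' cs with _ | ⟨z, ψ'⟩
    · rfl
    · simp only [Option.map_some, Option.some.injEq, Prod.mk.injEq, true_and]
      rw [Nat.mod_add_mod, Nat.add_assoc]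

/-! ### One item: exactly one admissible item per valid choice bit -/

/-- The state (label, phase) coded by `N + 3` bits. [folklore] -/
def decLP (r : List Bool) : PState N := (fun i => r.getD i false, bitsToNat (r.drop N))

/-- The item of `c :: a :: r` (`|r| = N + 3`). [folklore] -/
theorem decItem_cons_cons (c a : Bool) (r : List Bool) (hr : r.length = N + 3) :
    decItem (N := N) (c :: a :: r) = ⟨c, a, (decLP (N := N) r).1, (decLP (N := N) r).2⟩ := by
  have hl : (r.drop N).length = 3 := by rw [List.length_drop, hr]; omega
  simp only [decItem, decLP, List.getD_cons_zero, List.getD_cons_succ, show N + 2 = N + 1 + 1 from rfl,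
    List.drop_succ_cons, List.take_of_length_le hl.le, Item.mk.injEq, true_and, and_true]
  funext i
  rw [show 2 + (i : ℕ) = i + 1 + 1 by omega, List.getD_cons_succ, List.getD_cons_succ]

/-- The canonical code `List.ofFn w ++ bits3 φ` of a state. [folklore] -/
def encLP (t : PState N) : List Bool := List.ofFn t.1 ++ bits3 t.2

/-- Decoding the canonical code (phase `< 8`). [folklore] -/
theorem decLP_encLP {t : PState N} (ht : t.2 < 8) : decLP (N := N) (encLP t) = t := by
  rcases t with ⟨w, φ⟩
  unfold decLP encLP
  have hlen : (List.ofFn w).length = N := List.length_ofFn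
  simp only [Prod.mk.injEq]
  constructor
  · funext i
    rw [List.getD_eq_getElem _ _ (by simp [length_bits3]; omega), List.getElem_append_left (by simp)]
    simp
  · rw [List.drop_append_of_le_length hlen.ge, List.drop_of_length_le hlen.le, List.nil_append, bitsToNat_bits3 ht]

/-- A string of length `N + 3` is the canonical code of its state. [folklore] -/
theorem encLP_decLP (r : List Bool) (hr : r.length = N + 3) : encLP (decLP (N := N) r) = r := by
  unfold decLP encLP
  have hl : (r.drop N).length = 3 := by rw [List.length_drop, hr]; omega
  rw [bits3_bitsToNat _ hl]
  conv_rhs => rw [← List.take_append_drop N r]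
  congr 1
  apply List.ext_getElem
  · simp [hr]
  · intro i h1 h2
    simp only [List.getElem_ofFn, List.getElem_take]
    rw [List.getD_eq_getElem]

/-- **One item**: summing a function of the claimed state over the items that are a given step
(with the prescribed guess bit) picks the step's value, or nothing. [folklore] -/
theorem sum_item {β : Type*} [AddCommMonoid β] (out : Bool → Bool → Option (PState N))
    (hout : ∀ c a t, out c a = some t → t.2 < 8) (a₀ : Bool) (F : PState N → β) :
    ∑ v : List.Vector Bool (N + 5),
      (if out (decItem (N := N) v.toList).c (decItem (N := N) v.toList).a =
          some ((decItem (N := N) v.toList).lab, (decItem (N := N) v.toList).ph) ∧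
          (decItem (N := N) v.toList).a = a₀ then
        F ((decItem (N := N) v.toList).lab, (decItem (N := N) v.toList).ph) else 0) =
      ∑ c : Bool, (out c a₀).elim 0 F := by
  classical
  rw [show N + 5 = N + 3 + 1 + 1 from rfl, sum_vector_succ]
  refine Finset.sum_congr rfl fun c _ => ?_
  rw [sum_vector_succ, Fintype.sum_bool]
  have key : ∀ a : Bool, ∑ v : List.Vector Bool (N + 3),
      (if out (decItem (N := N) (c ::ᵥ a ::ᵥ v).toList).c (decItem (N := N) (c ::ᵥ a ::ᵥ v).toList).a =
          some ((decItem (N := N) (c ::ᵥ a ::ᵥ v).toList).lab, (decItem (N := N) (c ::ᵥ a ::ᵥ v).toList).ph) ∧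
          (decItem (N := N) (c ::ᵥ a ::ᵥ v).toList).a = a₀ then
        F ((decItem (N := N) (c ::ᵥ a ::ᵥ v).toList).lab, (decItem (N := N) (c ::ᵥ a ::ᵥ v).toList).ph) else 0) =
      if a = a₀ then (out c a₀).elim 0 F else 0 := by
    intro a
    have hdec : ∀ v : List.Vector Bool (N + 3), decItem (N := N) (c ::ᵥ a ::ᵥ v).toList =
        ⟨c, a, (decLP (N := N) v.toList).1, (decLP (N := N) v.toList).2⟩ := fun v => by
      rw [List.Vector.toList_cons, List.Vector.toList_cons, decItem_cons_cons c a _ (by simp)]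
    simp only [hdec]
    by_cases ha : a = a₀
    · subst ha
      simp only [and_true, if_true]
      rcases hoc : out c a with _ | t
      · simp
      · simp only [Option.some.injEq, Option.elim_some]
        obtain ⟨v₀, hv₀⟩ : ∃ v₀ : List.Vector Bool (N + 3), v₀.toList = encLP t :=
          ⟨⟨encLP t, by simp [encLP]⟩, rfl⟩
        rw [Fintype.sum_eq_single v₀]
        · have h1 : decLP (N := N) v₀.toList = t := by rw [hv₀]; exact decLP_encLP (hout c a t hoc)
          simp only [h1, Prod.mk.eta, if_true]
        · intro v hv
          rw [if_neg]
          intro heq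
          apply hv
          have hl : v.toList = v₀.toList := by
            rw [hv₀, heq, Prod.mk.eta, encLP_decLP _ (by simp)]
          exact List.Vector.toList_injective hl
    · rw [if_neg ha]
      exact Finset.sum_eq_zero fun v _ => by rw [if_neg (fun h => ha h.2)]
  rw [key, key]
  cases a₀ <;> simp

/-- `sum_item` for the local condition `itemOK`. [folklore] -/
theorem sum_itemOK {β : Type*} [AddCommMonoid β] (B : Language Bool) (g : QGate cliffordT N) (tbl : List (List Bool))
    (s : PState N) (F : PState N → β) :
    ∑ v : List.Vector Bool (iw N), (if itemOK B g tbl s (decItem (N := N) v.toList) then F (decItem (N := N) v.toList).st else 0) =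
      ∑ c : Bool, (stepOut g tbl c (guessOf B g s.1) s.1 s.2).elim 0 F :=
  sum_item (N := N) (fun c a => stepOut g tbl c a s.1 s.2) (fun _ _ _ h => stepOut_ph_lt' h) (guessOf B g s.1) F

/-! ### The admissible tableau is unique: the weighted count -/

/-- Sums over vectors of equal lengths agree. [folklore] -/
theorem sum_vector_congr_len {β : Type*} [AddCommMonoid β] {k k' : ℕ} (h : k = k') (g : List Bool → β) :
    ∑ Y : List.Vector Bool k, g Y.toList = ∑ Y : List.Vector Bool k', g Y.toList := by
  subst h; rfl

/-- Splitting a sum over `{0,1}^{a+m}` into the first block and the rest. [folklore] -/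
theorem sum_vector_add {β : Type*} [AddCommMonoid β] (a m : ℕ) (f : List Bool → β) :
    ∑ Y : List.Vector Bool (a + m), f Y.toList =
      ∑ u : List.Vector Bool a, ∑ v : List.Vector Bool m, f (u.toList ++ v.toList) := by
  induction a generalizing f with
  | zero =>
    rw [Fintype.sum_subsingleton _ List.Vector.nil]
    simp only [List.Vector.toList_nil, List.nil_append]
    exact sum_vector_congr_len (Nat.zero_add m) f
  | succ a ih =>
    rw [sum_vector_congr_len (show a + 1 + m = (a + m) + 1 by omega) f, sum_vector_succ, sum_vector_succ]
    refine Finset.sum_congr rfl fun b _ => ?_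
    simp only [List.Vector.toList_cons, List.cons_append]
    exact ih (fun l => f (b :: l))

/-- The summand of the pair count over runs. [folklore] -/
def runPair {β : Type*} [Zero β] (G : PState N → PState N → β) : Option (PState N) → Option (PState N) → β
  | some r₁, some r₂ => G r₁ r₂
  | _, _ => 0

/-- A dead second walk contributes nothing. [folklore] -/
@[simp] theorem runPair_none_right {β : Type*} [Zero β] (G : PState N → PState N → β) (o : Option (PState N)) :
    runPair G o none = 0 := by
  cases o <;> rfl

/-- **The admissible tableau is unique** (per pair of choice vectors): the weighted count of the
admissible tableaux of length `2(N+5)|gts| + e` from states `s₁, s₂` (phases `< 8`) is `2^e`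
times the sum, over pairs of choice vectors, of the weight of the pair of runs of the annotated
circuit `annOf B gts`. [cite: AaronsonChen2017, §5.3 (pp. 22–23)] [cite: AdlemanDeMarraisHuang1997, §6 Lemma 6.10 (proof: one configuration sequence per path)] -/
theorem sum_tabAdm {β : Type*} [AddCommMonoid β] (B : Language Bool) (gts : List (QGate cliffordT N × List (List Bool))) :
    ∀ (e m : ℕ), m = 2 * iw N * gts.length + e → ∀ (G : PState N → PState N → β) (s₁ s₂ : PState N),
    s₁.2 < 8 → s₂.2 < 8 →
    (∑ Y : List.Vector Bool m,
      (if tabAdm B gts s₁ s₂ Y.toList = true then G (tabFin gts s₁ s₂ Y.toList).1 (tabFin gts s₁ s₂ Y.toList).2 else 0)) =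
      2 ^ e • ∑ b : List.Vector Bool gts.length, ∑ b' : List.Vector Bool gts.length,
        runPair G (runSt (annOf B gts) s₁ b.toList) (runSt (annOf B gts) s₂ b'.toList) := by
  induction gts with
  | nil =>
    intro e m hm G s₁ s₂ h₁ h₂
    subst hm
    simp only [List.length_nil, Nat.mul_zero, tabAdm, if_true, tabFin]
    rw [Finset.sum_const, Finset.card_univ, card_vector, Fintype.card_bool,
      Fintype.sum_subsingleton _ List.Vector.nil, Fintype.sum_subsingleton _ List.Vector.nil,
      List.Vector.toList_nil, annOf, List.map_nil, runSt_nil h₁, runSt_nil h₂, Nat.zero_add]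
    rfl
  | cons gt rest ih =>
    intro e m hm G s₁ s₂ h₁ h₂
    obtain ⟨g, tbl⟩ := gt
    have hm' : m = iw N + (iw N + (2 * iw N * rest.length + e)) := by rw [hm, List.length_cons]; ring
    subst hm'
    -- the inner value after the two items: the induction hypothesis from the claimed states
    have hIH : ∀ t₁ t₂ : PState N, t₁.2 < 8 → t₂.2 < 8 →
        ∑ Y : List.Vector Bool (2 * iw N * rest.length + e),
          (if tabAdm B rest t₁ t₂ Y.toList = true then G (tabFin rest t₁ t₂ Y.toList).1 (tabFin rest t₁ t₂ Y.toList).2 else 0) =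
        2 ^ e • ∑ b : List.Vector Bool rest.length, ∑ b' : List.Vector Bool rest.length,
          runPair G (runSt (annOf B rest) t₁ b.toList) (runSt (annOf B rest) t₂ b'.toList) :=
      fun t₁ t₂ ht₁ ht₂ => ih e _ rfl G t₁ t₂ ht₁ ht₂
    -- split the tableau into the two items and the rest
    rw [sum_vector_add (iw N) (iw N + (2 * iw N * rest.length + e)) (fun l =>
      if tabAdm B ((g, tbl) :: rest) s₁ s₂ l = true then
        G (tabFin ((g, tbl) :: rest) s₁ s₂ l).1 (tabFin ((g, tbl) :: rest) s₁ s₂ l).2 else 0)]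
    have hinner : ∀ u : List.Vector Bool (iw N),
        ∑ Y' : List.Vector Bool (iw N + (2 * iw N * rest.length + e)),
          (if tabAdm B ((g, tbl) :: rest) s₁ s₂ (u.toList ++ Y'.toList) = true then
            G (tabFin ((g, tbl) :: rest) s₁ s₂ (u.toList ++ Y'.toList)).1
              (tabFin ((g, tbl) :: rest) s₁ s₂ (u.toList ++ Y'.toList)).2 else 0) =
        if itemOK B g tbl s₁ (decItem (N := N) u.toList) then
          ∑ v : List.Vector Bool (iw N),
            (if itemOK B g tbl s₂ (decItem (N := N) v.toList) then
              2 ^ e • ∑ b : List.Vector Bool rest.length, ∑ b' : List.Vector Bool rest.length,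
                runPair G (runSt (annOf B rest) (decItem (N := N) u.toList).st b.toList)
                  (runSt (annOf B rest) (decItem (N := N) v.toList).st b'.toList) else 0)
        else 0 := by
      intro u
      rw [sum_vector_add (iw N) (2 * iw N * rest.length + e) (fun l =>
        if tabAdm B ((g, tbl) :: rest) s₁ s₂ (u.toList ++ l) = true then
          G (tabFin ((g, tbl) :: rest) s₁ s₂ (u.toList ++ l)).1 (tabFin ((g, tbl) :: rest) s₁ s₂ (u.toList ++ l)).2 else 0)]
      have hrw : ∀ (v : List.Vector Bool (iw N)) (Y : List.Vector Bool (2 * iw N * rest.length + e)),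
          (if tabAdm B ((g, tbl) :: rest) s₁ s₂ (u.toList ++ (v.toList ++ Y.toList)) = true then
              G (tabFin ((g, tbl) :: rest) s₁ s₂ (u.toList ++ (v.toList ++ Y.toList))).1
                (tabFin ((g, tbl) :: rest) s₁ s₂ (u.toList ++ (v.toList ++ Y.toList))).2 else 0) =
          if itemOK B g tbl s₁ (decItem (N := N) u.toList) then
            (if itemOK B g tbl s₂ (decItem (N := N) v.toList) then
              (if tabAdm B rest (decItem (N := N) u.toList).st (decItem (N := N) v.toList).st Y.toList = true then
                G (tabFin rest (decItem (N := N) u.toList).st (decItem (N := N) v.toList).st Y.toList).1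
                  (tabFin rest (decItem (N := N) u.toList).st (decItem (N := N) v.toList).st Y.toList).2 else 0)
            else 0)
          else 0 := by
        intro v Y
        rw [tabAdm_cons_append B g tbl rest s₁ s₂ _ _ _ (by simp) (by simp),
          tabFin_cons_append (g, tbl) rest s₁ s₂ _ _ _ (by simp) (by simp)]
        by_cases h1 : itemOK B g tbl s₁ (decItem (N := N) u.toList)
        · by_cases h2 : itemOK B g tbl s₂ (decItem (N := N) v.toList)
          · simp [h1, h2]
          · simp [h1, h2]
        · simp [h1]
      simp_rw [hrw]
      by_cases h1 : itemOK B g tbl s₁ (decItem (N := N) u.toList)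
      · simp only [h1, if_true]
        refine Finset.sum_congr rfl fun v _ => ?_
        by_cases h2 : itemOK B g tbl s₂ (decItem (N := N) v.toList)
        · simp only [h2, if_true]
          exact hIH _ _ (decItem_ph_lt _) (decItem_ph_lt _)
        · simp only [h2, if_false]
          exact Finset.sum_eq_zero fun Y _ => rfl
      · simp only [h1, if_false]
        exact Finset.sum_eq_zero fun v _ => Finset.sum_eq_zero fun Y _ => rfl
    simp_rw [hinner]
    -- sum the two items
    have hv : ∀ u : List.Vector Bool (iw N),
        ∑ v : List.Vector Bool (iw N),
          (if itemOK B g tbl s₂ (decItem (N := N) v.toList) then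
            2 ^ e • ∑ b : List.Vector Bool rest.length, ∑ b' : List.Vector Bool rest.length,
              runPair G (runSt (annOf B rest) (decItem (N := N) u.toList).st b.toList)
                (runSt (annOf B rest) (decItem (N := N) v.toList).st b'.toList) else 0) =
        ∑ c' : Bool, (stepOut g tbl c' (guessOf B g s₂.1) s₂.1 s₂.2).elim 0 fun t =>
          2 ^ e • ∑ b : List.Vector Bool rest.length, ∑ b' : List.Vector Bool rest.length,
              runPair G (runSt (annOf B rest) (decItem (N := N) u.toList).st b.toList) (runSt (annOf B rest) t b'.toList) :=
      fun u => sum_itemOK B g tbl s₂ (fun t => 2 ^ e • ∑ b : List.Vector Bool rest.length, ∑ b' : List.Vector Bool rest.length,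
        runPair G (runSt (annOf B rest) (decItem (N := N) u.toList).st b.toList) (runSt (annOf B rest) t b'.toList))
    simp_rw [hv]
    have hu := sum_itemOK B g tbl s₁ (fun t₁ => ∑ c' : Bool, (stepOut g tbl c' (guessOf B g s₂.1) s₂.1 s₂.2).elim 0 fun t =>
      2 ^ e • ∑ b : List.Vector Bool rest.length, ∑ b' : List.Vector Bool rest.length,
          runPair G (runSt (annOf B rest) t₁ b.toList) (runSt (annOf B rest) t b'.toList))
    rw [hu]
    -- the right-hand side: peel the first choice bit of each walk
    rw [List.length_cons, sum_vector_succ, Finset.smul_sum]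
    refine Finset.sum_congr rfl fun c _ => ?_
    have hR : ∀ bb : List.Vector Bool rest.length,
        ∑ b' : List.Vector Bool (rest.length + 1),
          runPair G (runSt (annOf B ((g, tbl) :: rest)) s₁ (c ::ᵥ bb).toList) (runSt (annOf B ((g, tbl) :: rest)) s₂ b'.toList) =
        ∑ c' : Bool, ∑ bb' : List.Vector Bool rest.length,
          runPair G (runSt (annOf B ((g, tbl) :: rest)) s₁ (c ::ᵥ bb).toList)
            (runSt (annOf B ((g, tbl) :: rest)) s₂ (c' ::ᵥ bb').toList) :=
      fun bb => sum_vector_succ rest.length _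
    simp_rw [hR]
    simp only [annOf, List.map_cons, List.Vector.toList_cons, runSt_cons, stepOut_guessOf]
    rcases annPathStep (g, oracleJoin B {p | p ∈ tbl}) c s₁.1 with _ | ⟨w₁, ψ₁⟩
    · -- walk 1 dies: both sides vanish
      simp only [Option.map_none, Option.elim_none]
      symm
      rw [Finset.sum_eq_zero fun bb _ => ?_, smul_zero]
      exact Finset.sum_eq_zero fun c' _ => Finset.sum_eq_zero fun bb' _ => rfl
    · simp only [Option.map_some, Option.elim_some]
      rw [Finset.sum_comm, Finset.smul_sum]
      refine Finset.sum_congr rfl fun c' _ => ?_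
      rcases annPathStep (g, oracleJoin B {p | p ∈ tbl}) c' s₂.1 with _ | ⟨w₂, ψ₂⟩
      · simp only [Option.map_none, Option.elim_none]
        symm
        rw [Finset.sum_eq_zero fun bb _ => ?_, smul_zero]
        exact Finset.sum_eq_zero fun bb' _ => runPair_none_right G _
      · simp only [Option.map_some, Option.elim_some]

/-! ### Pair counts of a set of labels as sums over pairs of runs -/

open scoped Classical in
/-- The pair-count summand of weight `f` for a set of labels, read off two runs (endpoints and
phases): `f ((φ₁ + 7φ₂) mod 8)` if both runs are valid and end at the same label of `S`, else `0`.
[cite: AdlemanDeMarraisHuang1997, §6 Lemma 6.10 (proof)] -/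
def clsTerm (f : ℕ → ℤ) (S : Set (QReg N)) : Option (PState N) → Option (PState N) → ℤ
  | some r₁, some r₂ => if r₁.1 = r₂.1 ∧ r₁.1 ∈ S then f ((r₁.2 + 7 * r₂.2) % 8) else 0
  | _, _ => 0

open scoped Classical in
/-- `clsTerm` is a `runPair`. [folklore] -/
theorem clsTerm_eq_runPair (f : ℕ → ℤ) (S : Set (QReg N)) (o₁ o₂ : Option (PState N)) :
    clsTerm f S o₁ o₂ = runPair (fun r₁ r₂ => if r₁.1 = r₂.1 ∧ r₁.1 ∈ S then f ((r₁.2 + 7 * r₂.2) % 8) else 0) o₁ o₂ := by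
  rcases o₁ with _ | r₁ <;> rcases o₂ with _ | r₂ <;> rfl

open scoped Classical in
/-- The phase class read off the runs from phase `0` is the class of the raw path phases. [folklore] -/
theorem clsTerm_runSt_zero (f : ℕ → ℤ) (S : Set (QReg N)) (gas : List (AnnGate N)) (w : QReg N) (bs bs' : List Bool) :
    clsTerm f S (runSt gas (w, 0) bs) (runSt gas (w, 0) bs') =
      match annPathRun gas w bs, annPathRun gas w bs' with
      | some (z₁, φ), some (z₂, φ') => if z₁ = z₂ ∧ z₁ ∈ S then f ((φ + 7 * φ') % 8) else 0
      | _, _ => 0 := by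
  unfold runSt
  rcases annPathRun gas w bs with _ | ⟨z₁, φ⟩ <;> rcases annPathRun gas w bs' with _ | ⟨z₂, φ'⟩ <;>
    simp only [Option.map_none, Option.map_some, clsTerm]
  simp only [Nat.zero_add]
  split_ifs
  · congr 1
    rw [Nat.add_mod, Nat.mod_mod, Nat.mul_mod, Nat.mod_mod, ← Nat.mul_mod, ← Nat.add_mod]
  · rfl

open scoped Classical in
/-- **`A_S` as a sum over pairs of runs.** [cite: AdlemanDeMarraisHuang1997, §6 Lemma 6.10 (proof)] -/
theorem annSetA_eq_sum_runSt (gas : List (AnnGate N)) (w : QReg N) (S : Set (QReg N)) :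
    annSetA gas w S = ∑ b : List.Vector Bool gas.length, ∑ b' : List.Vector Bool gas.length,
      clsTerm reA S (runSt gas (w, 0) b.toList) (runSt gas (w, 0) b'.toList) := by
  unfold annSetA
  refine (sum_fn_fn_eq_sum_vector (m := gas.length) rfl (fun bs bs' =>
      match annPathRun gas w bs, annPathRun gas w bs' with
      | some (z₁, φ), some (z₂, φ') => if z₁ = z₂ ∧ z₁ ∈ S then reA ((φ + 7 * φ') % 8) else 0
      | _, _ => (0 : ℤ))).trans ?_
  refine Finset.sum_congr rfl fun b _ => Finset.sum_congr rfl fun b' _ => ?_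
  rw [clsTerm_runSt_zero]

open scoped Classical in
/-- **`B_S` as a sum over pairs of runs.** [cite: AdlemanDeMarraisHuang1997, §6 Lemma 6.10 (proof)] -/
theorem annSetB_eq_sum_runSt (gas : List (AnnGate N)) (w : QReg N) (S : Set (QReg N)) :
    annSetB gas w S = ∑ b : List.Vector Bool gas.length, ∑ b' : List.Vector Bool gas.length,
      clsTerm reB S (runSt gas (w, 0) b.toList) (runSt gas (w, 0) b'.toList) := by
  unfold annSetB
  refine (sum_fn_fn_eq_sum_vector (m := gas.length) rfl (fun bs bs' =>
      match annPathRun gas w bs, annPathRun gas w bs' with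
      | some (z₁, φ), some (z₂, φ') => if z₁ = z₂ ∧ z₁ ∈ S then reB ((φ + 7 * φ') % 8) else 0
      | _, _ => (0 : ℤ))).trans ?_
  refine Finset.sum_congr rfl fun b _ => Finset.sum_congr rfl fun b' _ => ?_
  rw [clsTerm_runSt_zero]

/-- **The dyadic class value of a pair of runs and the dyadic numerator**: summing
`clsVal k` of the class datum (same label in `S`) over pairs of runs gives
`dyadicGap A_S B_S k = 2^{k+1} A_S + ⌊2^k√2⌋ B_S`. [cite: FortnowRogers1999JCSS, Lemma 3.2 (arXiv numbering)] -/
theorem sum_clsTerm_clsVal (gas : List (AnnGate N)) (w : QReg N) (S : Set (QReg N)) (k : ℕ) :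
    (∑ b : List.Vector Bool gas.length, ∑ b' : List.Vector Bool gas.length,
      clsTerm (fun d => clsVal k (some d)) S (runSt gas (w, 0) b.toList) (runSt gas (w, 0) b'.toList)) =
      dyadicGap (annSetA gas w S) (annSetB gas w S) k := by
  rw [dyadicGap, annSetA_eq_sum_runSt, annSetB_eq_sum_runSt, Finset.mul_sum, Finset.mul_sum, ← Finset.sum_add_distrib]
  refine Finset.sum_congr rfl fun b _ => ?_
  rw [Finset.mul_sum, Finset.mul_sum, ← Finset.sum_add_distrib]
  refine Finset.sum_congr rfl fun b' _ => ?_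
  rcases runSt gas (w, 0) b.toList with _ | r₁ <;> rcases runSt gas (w, 0) b'.toList with _ | r₂ <;>
    simp only [clsTerm, mul_zero, add_zero]
  split_ifs <;> simp [clsVal]

/-! ### Counting lemmas on the witness blocks -/

/-- A sum of an indicator-weighted constant over `{0,1}^m` is the count times the constant. [folklore] -/
theorem sum_vector_ite_const {β : Type*} [AddCommMonoid β] (m : ℕ) (E : Set (List Bool)) [DecidablePred (· ∈ E)] (x : β) :
    ∑ v : List.Vector Bool m, (if v.toList ∈ E then x else 0) = cnt m E • x := by
  classical
  rw [cnt, Finset.card_eq_sum_ones, Finset.sum_smul, Finset.sum_filter]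
  refine Finset.sum_congr rfl fun v _ => ?_
  split_ifs <;> simp

/-- **The coefficient block**: `Σ_{t ∈ {0,1}^m} [⟦t⟧ < n] = n` for `n ≤ 2^m`. [folklore] -/
theorem sum_vector_bitsToNat_lt {β : Type*} [AddCommMonoid β] (m n : ℕ) (hn : n ≤ 2 ^ m) (x : β) :
    ∑ t : List.Vector Bool m, (if bitsToNat t.toList < n then x else 0) = n • x := by
  have h := sum_vector_ite_const m {t : List Bool | bitsToNat t < n} x
  simp only [Set.mem_setOf_eq] at h
  rw [h, cnt_bitsToNat_lt m n hn]

/-- **The multiplicity block**: `Σ_{u ∈ {0,1}^K} [uTest k d u] = clsWt k d` for `K ≥ k + 1`. [folklore] -/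
theorem sum_vector_uTest {β : Type*} [AddCommMonoid β] (k d K : ℕ) (hK : k + 1 ≤ K) (x : β) :
    ∑ u : List.Vector Bool K, (if uTest k d u.toList = true then x else 0) = clsWt k d • x := by
  have h := sum_vector_ite_const K {u : List Bool | uTest k d u = true} x
  simp only [Set.mem_setOf_eq] at h
  rw [h, cnt_uTest k d K hK]

/-- `clsWt · (clsAcc true − clsAcc false) = clsVal`: the multiplicity-weighted sign of a class.
[cite: FortnowRogers1999JCSS, Lemma 3.2 (arXiv numbering)] -/
theorem clsWt_mul_clsAcc_sub (k d : ℕ) :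
    ((clsWt k d : ℤ) * (if clsAcc true d = true then 1 else 0) - (clsWt k d : ℤ) * (if clsAcc false d = true then 1 else 0)) =
      clsVal k (some d) := by
  have h := pairTerm_sub k (some d)
  simp only [pairTerm] at h
  rw [← h]
  split_ifs <;> ring

/-! ### The exact sign of the dyadic numerator -/

/-- **Exact sign of the dyadic numerator.** For integers `a, b` with `4b² < 2^k`:
`0 < dyadicGap a b k = 2^{k+1} a + ⌊2^k√2⌋ b ↔ 0 < 2a + √2 b`. If `b = 0` the numerator is exact;
otherwise `|2a + √2 b| ≥ 1/(4|b|)` by the irrationality measure of `√2`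
(`one_div_le_abs_sqrt_two_mul_sub`) while the numerator over `2^k` is within `|b|/2^k < 1/(4|b|)`
of `2a + √2 b` (`abs_sqrtTwoFloor_sub_le`). The EXACT comparisons of the `PSPACE^{TQBF}` simulator
("all the computations can be done in PSPACE") rest on this. [cite: AaronsonChen2017, §5.3 (p. 23)] -/
theorem dyadicGap_pos_iff (a b : ℤ) (k : ℕ) (hk : 4 * b ^ 2 < 2 ^ k) :
    0 < dyadicGap a b k ↔ (0 : ℝ) < 2 * a + Real.sqrt 2 * b := by
  have h2k : (0 : ℝ) < 2 ^ k := by positivity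
  set y : ℝ := (dyadicGap a b k : ℝ) / 2 ^ k with hy
  have hy_eq : y = 2 * a + (sqrtTwoFloor k : ℝ) / 2 ^ k * b := by
    rw [hy, dyadicGap]; push_cast; field_simp; ring
  have hsign : 0 < dyadicGap a b k ↔ 0 < y := by
    rw [hy, lt_div_iff₀ h2k, zero_mul]
    exact_mod_cast Iff.rfl
  rw [hsign]
  set x : ℝ := 2 * a + Real.sqrt 2 * b with hx
  have herr : |y - x| ≤ |(b : ℝ)| / 2 ^ k := by
    have e : y - x = (b : ℝ) * (((sqrtTwoFloor k : ℝ) - 2 ^ k * Real.sqrt 2) / 2 ^ k) := by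
      rw [hy_eq, hx]; field_simp; ring
    rw [e, abs_mul, abs_div, abs_of_pos h2k, ← mul_div_assoc]
    exact div_le_div_of_nonneg_right (mul_le_of_le_one_right (abs_nonneg _) (abs_sqrtTwoFloor_sub_le k))
      h2k.le
  by_cases hb : b = 0
  · subst hb
    have : y = x := by rw [hy_eq, hx]; simp
    rw [this]
  · have hbR : (b : ℝ) ≠ 0 := by exact_mod_cast hb
    have hbpos : 0 < |(b : ℝ)| := abs_pos.2 hbR
    have hmargin : 1 / (4 * |(b : ℝ)|) ≤ |x| := by
      have h := one_div_le_abs_sqrt_two_mul_sub (-(2 * a)) b hb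
      rw [hx]
      convert h using 2
      push_cast; ring
    have herr' : |(b : ℝ)| / 2 ^ k < 1 / (4 * |(b : ℝ)|) := by
      rw [div_lt_div_iff₀ h2k (by positivity), one_mul]
      have hk' : (4 : ℝ) * (b : ℝ) ^ 2 < 2 ^ k := by exact_mod_cast hk
      calc |(b : ℝ)| * (4 * |(b : ℝ)|) = 4 * (b : ℝ) ^ 2 := by rw [← sq_abs]; ring
        _ < 2 ^ k := hk'
    have hlt : |y - x| < |x| := lt_of_le_of_lt herr (lt_of_lt_of_le herr' hmargin)
    constructor
    · intro hy0
      by_contra hx0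
      push Not at hx0
      rw [abs_of_nonpos hx0] at hlt
      have h1 : y - x ≤ |y - x| := le_abs_self _
      linarith
    · intro hx0
      have h1 : -(y - x) ≤ |y - x| := neg_le_abs _
      rw [abs_of_pos hx0] at hlt
      linarith

end AcTab

end Literature.Barriers.QuantumAdvantage

end
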